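import Literature.NumberTheory.Sieve.Polymath8aTypeEstimates
import HarnessLib

/-!
# Polymath 8a, Theorem 2.4 from Lemma 2.7 and Theorem 2.8 (the choice of `σ`)

D. H. J. Polymath, *New equidistribution estimates of Zhang type*, Algebra & Number Theory 8:9
(2014) 2067–2199 = arXiv:1402.0811.  `Polymath8aTypeEstimates.lean` vendors Definition 2.6
(`Polymath8a.TypeI/TypeII/TypeIII`) and the named facts Lemma 2.7 (`Polymath8a.mpzi_of_typeEstimates`)
and Theorem 2.8 (i)–(v) (`Polymath8a.typeI_one_of_lt`, `typeI_two_of_lt`, `typeI_four_of_lt`,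
`typeII_one_of_lt`, `typeIII_one_of_lt`).  This file PROVES from them, by the choice of `σ` that the
paper leaves to the reader (every constraint is linear in `(ϖ, δ, σ)`):

* `Polymath8a.mpzi_of_typeI_of_typeII` — the rider of Lemma 2.7: "if `σ > 1/6`, then the
  hypothesis `Type_III^{(i)}[ϖ, δ, σ]` may be omitted" (the range (2-13) is empty,
  `TypeIII.of_one_sixth_lt`);
* `Polymath8a.mpzi_four_of_lt` — **Theorem 2.4 (i)**: `MPZ^{(4)}[ϖ, δ]` for all `ϖ, δ > 0` with
  `600ϖ + 180δ < 7` (from (iii), (iv), (v); `σ = 1/10 + s/100`, `s` the slack; at `σ = 1/10` the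
  binding constraint `(160/3)ϖ + 16δ + (34/9)σ < 1` of (iii) is exactly `600ϖ + 180δ < 7`), and
  `Polymath8a.mpz_of_lt_of_typeEstimates` — hence the tree's named fact **parity.S29** `mpz_of_lt`
  (`ParityWave0.lean`), through `mpz_of_lt_of_mpzi_four` (`ParityWave0MPZClaim.lean`): the trust
  base of `mpz_of_lt` is thereby refined to the four printed statements Lemma 2.7 and
  Theorem 2.8 (iii), (iv), (v);
* `Polymath8a.mpzi_two_of_lt_deligneFree` — **Theorem 2.4 (ii)**: `MPZ^{(2)}[ϖ, δ]` for all
  `ϖ, δ > 0` with `168ϖ + 48δ < 1`, from (ii) and (iv) only ("without invoking any of Deligne's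
  results"): the window `1/6 < σ < (1 − 56ϖ − 16δ)/4` is non-empty exactly when `168ϖ + 48δ < 1`.

Nothing here is a new fact; nothing discharges Lemma 2.7 or Theorem 2.8.

## References

* D. H. J. Polymath, *New equidistribution estimates of Zhang type*, Algebra & Number Theory 8:9
  (2014), 2067–2199, arXiv:1402.0811: Theorem 2.4 (p. 2076), Lemma 2.7 and Theorem 2.8 (p. 2079),
  Lemma 3.1 (p. 2084). [cite: Polymath8a2014]
-/

namespace Literature.NumberTheory.Sieve

namespace Polymath8a

/-- **Lemma 2.7, rider**: "if `σ > 1/6`, then the hypothesis `Type_III^{(i)}[ϖ, δ, σ]` may be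
omitted" — from Lemma 2.7 and the vacuity `TypeIII.of_one_sixth_lt`. [cite: Polymath8a2014, Lemma 2.7 (p. 2079)] -/
theorem mpzi_of_typeI_of_typeII (h27 : mpzi_of_typeEstimates) {i : ℕ} {ϖ δ σ : ℝ} (hi : 1 ≤ i)
    (hϖ : 0 < ϖ) (hϖ' : ϖ < 1 / 4) (hδ : 0 < δ) (hδ' : δ < 1 / 4 + ϖ) (hσ : 1 / 6 < σ)
    (hσ' : σ < 1 / 2) (hσϖ : 2 * ϖ < σ) (hI : TypeI i ϖ δ σ) (hII : TypeII i ϖ δ) : MPZi i ϖ δ :=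
  h27 i ϖ δ σ hi hϖ hϖ' hδ hδ' (by linarith) hσ' hσϖ hI hII (TypeIII.of_one_sixth_lt i ϖ δ hσ)

/-- **Polymath 8a, Theorem 2.4 (i)** from Lemma 2.7 and Theorem 2.8 (iii), (iv), (v): "We have
`MPZ^{(4)}[ϖ, δ]` for any fixed `ϖ, δ > 0` such that `600ϖ + 180δ < 7`."  Choice of `σ`: with the
slack `s = 7 − 600ϖ − 180δ > 0` take `σ = 1/10 + s/100`; at `σ = 1/10` the binding constraint
`(160/3)ϖ + 16δ + (34/9)σ < 1` of (iii) is exactly `600ϖ + 180δ < 7`, and (iv), (v) (at `i = 1`,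
lifted to `i = 4` by Lemma 2.10 (0)) and the hypotheses of Lemma 2.7 follow linearly.
[cite: Polymath8a2014, Theorem 2.4 (i) (p. 2076), deduced from Lemma 2.7 and Theorem 2.8] -/
theorem mpzi_four_of_lt (h27 : mpzi_of_typeEstimates) (h28iii : typeI_four_of_lt)
    (h28iv : typeII_one_of_lt) (h28v : typeIII_one_of_lt) {ϖ δ : ℝ} (hϖ : 0 < ϖ) (hδ : 0 < δ)
    (h : 600 * ϖ + 180 * δ < 7) : MPZi 4 ϖ δ := by
  set σ : ℝ := 1 / 10 + (7 - 600 * ϖ - 180 * δ) / 100 with hσ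
  have hϖ4 : ϖ < 1 / 4 := by linarith
  have hϖ12 : ϖ < 1 / 12 := by linarith
  have hδ4 : δ < 1 / 4 + ϖ := by linarith
  have hσ0 : 0 < σ := by rw [hσ]; linarith
  have hσl : 1 / 10 < σ := by rw [hσ]; linarith
  have hσr : σ < 1 / 2 := by rw [hσ]; linarith
  have hσϖ : 2 * ϖ < σ := by rw [hσ]; linarith
  have hIa : 160 / 3 * ϖ + 16 * δ + 34 / 9 * σ < 1 := by rw [hσ]; linarith
  have hIb : 64 * ϖ + 18 * δ + 2 * σ < 1 := by rw [hσ]; linarith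
  have hII : 68 * ϖ + 14 * δ < 1 := by linarith
  have hIII : 1 / 18 + 28 / 9 * ϖ + 2 / 9 * δ < σ := by rw [hσ]; linarith
  exact h27 4 ϖ δ σ (by norm_num) hϖ hϖ4 hδ hδ4 hσl hσr hσϖ
    (h28iii ϖ δ σ hϖ hϖ4 hδ hδ4 hσ0 hσr hIa hIb)
    ((h28iv ϖ δ hϖ hϖ4 hδ hδ4 hII).anti_index (by norm_num))
    ((h28v ϖ δ σ hϖ hϖ12 hδ hδ4 hσ0 hσr hIII).anti_index (by norm_num))

/-- **parity.S29 from Lemma 2.7 and Theorem 2.8**: the tree's named fact `mpz_of_lt`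
(`MPZ[ϖ, δ]` for all `ϖ, δ > 0` with `600ϖ + 180δ < 7`, `ParityWave0.lean`) follows from the named
facts of `Polymath8aTypeEstimates.lean`, through Theorem 2.4 (i) (`mpzi_four_of_lt`) and `mpz_of_lt_of_mpzi_four`.
[cite: Polymath8a2014, Theorem 2.4 (i) and the display after it] -/
theorem mpz_of_lt_of_typeEstimates (h27 : mpzi_of_typeEstimates) (h28iii : typeI_four_of_lt)
    (h28iv : typeII_one_of_lt) (h28v : typeIII_one_of_lt) : mpz_of_lt :=
  mpz_of_lt_of_mpzi_four fun _ _ hϖ hδ h => mpzi_four_of_lt h27 h28iii h28iv h28v hϖ hδ h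

/-- **Polymath 8a, Theorem 2.4 (ii)** from Lemma 2.7 (with its rider) and Theorem 2.8 (ii), (iv)
only: "We can prove `MPZ^{(2)}[ϖ, δ]` for any fixed `ϖ, δ > 0` such that `168ϖ + 48δ < 1`, without
invoking any of Deligne's results".  Choice of `σ`: the window `1/6 < σ < (1 − 56ϖ − 16δ)/4` is
non-empty exactly when `168ϖ + 48δ < 1`; take its midpoint; `Type_II^{(2)}` comes from (iv) by
Lemma 2.10 (0).  The Deligne-dependent facts (iii), (v) are not hypotheses of this theorem.
[cite: Polymath8a2014, Theorem 2.4 (ii) (p. 2076), deduced from Lemma 2.7 and Theorem 2.8 (ii), (iv)] -/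
theorem mpzi_two_of_lt_deligneFree (h27 : mpzi_of_typeEstimates) (h28ii : typeI_two_of_lt)
    (h28iv : typeII_one_of_lt) {ϖ δ : ℝ} (hϖ : 0 < ϖ) (hδ : 0 < δ) (h : 168 * ϖ + 48 * δ < 1) :
    MPZi 2 ϖ δ := by
  set σ : ℝ := (1 / 6 + (1 - 56 * ϖ - 16 * δ) / 4) / 2 with hσ
  have hϖ4 : ϖ < 1 / 4 := by linarith
  have hδ4 : δ < 1 / 4 + ϖ := by linarith
  have hσ0 : 0 < σ := by rw [hσ]; linarith
  have hσl : 1 / 6 < σ := by rw [hσ]; linarith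
  have hσr : σ < 1 / 2 := by rw [hσ]; linarith
  have hσϖ : 2 * ϖ < σ := by rw [hσ]; linarith
  have hI : 56 * ϖ + 16 * δ + 4 * σ < 1 := by rw [hσ]; linarith
  have hII : 68 * ϖ + 14 * δ < 1 := by linarith
  exact mpzi_of_typeI_of_typeII h27 (by norm_num) hϖ hϖ4 hδ hδ4 hσl hσr hσϖ
    (h28ii ϖ δ σ hϖ hϖ4 hδ hδ4 hσ0 hσr hI) ((h28iv ϖ δ hϖ hϖ4 hδ hδ4 hII).anti_index (by norm_num))

end Polymath8a

end Literature.NumberTheory.Sieve
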